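import Mathlib.Analysis.Normed.Group.Basic
import Mathlib.Analysis.SpecificLimits.Basic
import HarnessLib

/-!
# Route `InfraredLiouville`, item `RepellerLemma` — a parabolic step repels from the origin in its marginal
direction (abstract chart dynamics)

Support file for item `stmt-QuantumFields-9757` (`RepellerLemma`, card K2 "asymptotic freedom forbids infrared
freedom" of route `InfraredLiouville` on `YangMills`; the item is INFORMAL at the time of writing — no route decl
exists yet — so nothing here closes it). This file proves the CHART-LEVEL DYNAMICS half of K2, i.e. the
corollary "nothing coming from `g ≠ 0` can accumulate at the free fixed point", for every parabolic normal form
of one renormalisation step, in the literal hypothesis shape of the tree's posited chart structures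
(`BalabanBanachStep.remainder` / `remainder_basin`, `ParabolicBlock`, `BasinBlock` of
`Literature.MathematicalPhysics.QuantumFieldTheory`); the companion file
`InfraredLiouvilleRepellerLemmaBalabanRepeller` specialises everything to an inhabitant
`S : BalabanBanachStep G r M` and to Wilson orbits.

Setting: any real normed group `E`, any coupling map `φ : ℝ → E → ℝ` with
`|φ g y − (g + b g³)| ≤ C (g⁴ + |g|³ ‖y‖)` on `|g|, ‖y‖ ≤ δ` (the sign `0 < b = b₀ log M` is asymptotic
freedom), and, where needed, a fibre map `Ψ` with `‖Ψ g y‖ ≤ θ' ‖y‖ + C g²`.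

* `abs_add_le_abs_map` — on the box `|g|, ‖y‖ ≤ δ₁` with `4 C δ₁ ≤ b` one step preserves the sign of the
  coupling and increases its modulus by at least `(b/2)|g|³`.
* `eventually_fst_eq_zero_of_tendsto` — an orbit of ANY map whose coupling coordinate is renormalised by `φ`
  that converges to the origin `(0, 0)` has identically vanishing coupling from some step on (nothing is
  assumed about the fibre map).
* `exists_escape` / `fst_eq_zero_of_forall_abs_le` — with the fibre bound and `θ' δ₁ + C δ₁² ≤ δ₁`: every
  orbit with fibre started in `B̄_{δ₁}` and coupling `g₀ ≠ 0` reaches `|g| > δ₁` (linear growth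
  `|g₀| + k (b/2)|g₀|³ ≤ |g_k|` while inside), so the local stable set of the origin lies in `{g = 0}`.
* `exists_repellerRadius_of_consts` (`'`) — such radii `δ₁` exist for any `0 < δ`, `0 < b`, `0 ≤ C`, `θ' < 1`.

What is NOT here: any chart for Wilson's action (Bałaban's programme), and the bridge from infrared limit points
of the typed class of `IRLiouville` (distributional limits on ⁰𝒮) to blocked effective actions in a chart — the
pieces the planner must type before `RepellerLemma` has a Lean statement.
-/

open Filter Topology

namespace Summit.QuantumFields.YangMills.Theorems.RepellerLemma

/-! ### A parabolic lower bound makes the origin repelling in the marginal direction -/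

section Abstract

variable {E : Type} [NormedAddCommGroup E] {φ : ℝ → E → ℝ} {Ψ : ℝ → E → E} {b C δ δ₁ θ' : ℝ}

/-- On the box `|g| ≤ δ₁`, `‖y‖ ≤ δ₁` (`δ₁ ≤ δ`) the parabolic remainder is at most `2 C δ₁ |g|³`. [folklore] -/
theorem abs_remainder_le
    (H : ∀ g : ℝ, ∀ y : E, |g| ≤ δ → ‖y‖ ≤ δ →
      |φ g y - (g + b * g ^ 3)| ≤ C * (g ^ 4 + |g| ^ 3 * ‖y‖))
    (hC : 0 ≤ C) (hδ₁δ : δ₁ ≤ δ) {g : ℝ} {y : E} (hg : |g| ≤ δ₁) (hy : ‖y‖ ≤ δ₁) :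
    |φ g y - (g + b * g ^ 3)| ≤ 2 * C * δ₁ * |g| ^ 3 := by
  have h := H g y (hg.trans hδ₁δ) (hy.trans hδ₁δ)
  have hg3 : 0 ≤ |g| ^ 3 := by positivity
  have e4 : g ^ 4 = |g| * |g| ^ 3 := by
    have : |g| ^ 4 = g ^ 4 := by rw [← abs_pow]; exact abs_of_nonneg (by positivity)
    rw [← this]; ring
  have h4 : g ^ 4 ≤ δ₁ * |g| ^ 3 := by
    rw [e4]; exact mul_le_mul_of_nonneg_right hg hg3
  have h5 : |g| ^ 3 * ‖y‖ ≤ δ₁ * |g| ^ 3 := by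
    rw [mul_comm]; exact mul_le_mul_of_nonneg_right hy hg3
  calc |φ g y - (g + b * g ^ 3)| ≤ C * (g ^ 4 + |g| ^ 3 * ‖y‖) := h
    _ ≤ C * (δ₁ * |g| ^ 3 + δ₁ * |g| ^ 3) := mul_le_mul_of_nonneg_left (add_le_add h4 h5) hC
    _ = 2 * C * δ₁ * |g| ^ 3 := by ring

/-- **Sign preservation, non-negative couplings**: on the box with `4 C δ₁ ≤ b`, `0 ≤ g` implies
`g + (b/2) g³ ≤ φ g y`. [folklore] -/
theorem add_cube_le_map_of_nonneg
    (H : ∀ g : ℝ, ∀ y : E, |g| ≤ δ → ‖y‖ ≤ δ →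
      |φ g y - (g + b * g ^ 3)| ≤ C * (g ^ 4 + |g| ^ 3 * ‖y‖))
    (hC : 0 ≤ C) (hδ₁δ : δ₁ ≤ δ) (h4 : 4 * C * δ₁ ≤ b) {g : ℝ} {y : E} (hg : |g| ≤ δ₁)
    (hy : ‖y‖ ≤ δ₁) (hg0 : 0 ≤ g) : g + b / 2 * g ^ 3 ≤ φ g y := by
  have h := abs_remainder_le H hC hδ₁δ hg hy
  rw [abs_of_nonneg hg0] at h
  have hg3 : 0 ≤ g ^ 3 := by positivity
  have hb : 2 * C * δ₁ * g ^ 3 ≤ b / 2 * g ^ 3 :=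
    mul_le_mul_of_nonneg_right (by linarith) hg3
  have h' := (abs_le.1 (h.trans hb)).1
  linarith

/-- **Sign preservation, non-positive couplings**: on the box with `4 C δ₁ ≤ b`, `g ≤ 0` implies
`φ g y ≤ g + (b/2) g³`. [folklore] -/
theorem map_le_add_cube_of_nonpos
    (H : ∀ g : ℝ, ∀ y : E, |g| ≤ δ → ‖y‖ ≤ δ →
      |φ g y - (g + b * g ^ 3)| ≤ C * (g ^ 4 + |g| ^ 3 * ‖y‖))
    (hC : 0 ≤ C) (hδ₁δ : δ₁ ≤ δ) (h4 : 4 * C * δ₁ ≤ b) {g : ℝ} {y : E} (hg : |g| ≤ δ₁)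
    (hy : ‖y‖ ≤ δ₁) (hg0 : g ≤ 0) : φ g y ≤ g + b / 2 * g ^ 3 := by
  have h := abs_remainder_le H hC hδ₁δ hg hy
  rw [abs_of_nonpos hg0] at h
  have hg3 : 0 ≤ (-g) ^ 3 := pow_nonneg (by linarith) 3
  have hb : 2 * C * δ₁ * (-g) ^ 3 ≤ b / 2 * (-g) ^ 3 :=
    mul_le_mul_of_nonneg_right (by linarith) hg3
  have h' := (abs_le.1 (h.trans hb)).2
  have e3 : (-g) ^ 3 = -g ^ 3 := by ring
  rw [e3] at h'
  linarith

/-- **Modulus growth** ("the free fixed point repels in the marginal direction"): on the box `|g|, ‖y‖ ≤ δ₁`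
with `δ₁ ≤ δ` and `4 C δ₁ ≤ b`, one step gives `|g| + (b/2)|g|³ ≤ |φ g y|`. [folklore] -/
theorem abs_add_le_abs_map
    (H : ∀ g : ℝ, ∀ y : E, |g| ≤ δ → ‖y‖ ≤ δ →
      |φ g y - (g + b * g ^ 3)| ≤ C * (g ^ 4 + |g| ^ 3 * ‖y‖))
    (hC : 0 ≤ C) (hδ₁δ : δ₁ ≤ δ) (h4 : 4 * C * δ₁ ≤ b) {g : ℝ} {y : E} (hg : |g| ≤ δ₁)
    (hy : ‖y‖ ≤ δ₁) : |g| + b / 2 * |g| ^ 3 ≤ |φ g y| := by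
  have hb0 : 0 ≤ b := by
    have : 0 ≤ δ₁ := (abs_nonneg g).trans hg
    nlinarith
  rcases le_total 0 g with hg0 | hg0
  · have h := add_cube_le_map_of_nonneg H hC hδ₁δ h4 hg hy hg0
    have hg3 : 0 ≤ g ^ 3 := by positivity
    have hφ0 : 0 ≤ φ g y := by nlinarith
    rw [abs_of_nonneg hg0, abs_of_nonneg hφ0]
    exact h
  · have h := map_le_add_cube_of_nonpos H hC hδ₁δ h4 hg hy hg0
    have hg3 : g ^ 3 ≤ 0 := by
      have : 0 ≤ (-g) ^ 3 := pow_nonneg (by linarith) 3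
      nlinarith
    have hφ0 : φ g y ≤ 0 := by nlinarith
    rw [abs_of_nonpos hg0, abs_of_nonpos hφ0]
    have e3 : (-g) ^ 3 = -g ^ 3 := by ring
    rw [e3]
    linarith

/-- Weak form of modulus growth: `|g| ≤ |φ g y|` on the box. [folklore] -/
theorem abs_le_abs_map
    (H : ∀ g : ℝ, ∀ y : E, |g| ≤ δ → ‖y‖ ≤ δ →
      |φ g y - (g + b * g ^ 3)| ≤ C * (g ^ 4 + |g| ^ 3 * ‖y‖))
    (hC : 0 ≤ C) (hδ₁δ : δ₁ ≤ δ) (h4 : 4 * C * δ₁ ≤ b) {g : ℝ} {y : E} (hg : |g| ≤ δ₁)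
    (hy : ‖y‖ ≤ δ₁) : |g| ≤ |φ g y| := by
  have h := abs_add_le_abs_map H hC hδ₁δ h4 hg hy
  have hb0 : 0 ≤ b := by
    have : 0 ≤ δ₁ := (abs_nonneg g).trans hg
    nlinarith
  have : 0 ≤ b / 2 * |g| ^ 3 := by positivity
  linarith

/-- **No orbit reaches the free fixed point from `g ≠ 0`.** Let `p : ℕ → ℝ × E` be an orbit of ANY map whose
coupling coordinate is renormalised by `φ` (`(p (k+1)).1 = φ (p k).1 (p k).2`; nothing is assumed about the
fibre map). If `p k → (0, 0)`, then the coupling vanishes identically from some step on. (Once the orbit is in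
the box, `|g|` is non-decreasing, so it can only tend to `0` by being `0`.) [folklore] -/
theorem eventually_fst_eq_zero_of_tendsto
    (H : ∀ g : ℝ, ∀ y : E, |g| ≤ δ → ‖y‖ ≤ δ →
      |φ g y - (g + b * g ^ 3)| ≤ C * (g ^ 4 + |g| ^ 3 * ‖y‖))
    (hC : 0 ≤ C) (hδ₁ : 0 < δ₁) (hδ₁δ : δ₁ ≤ δ) (h4 : 4 * C * δ₁ ≤ b)
    (p : ℕ → ℝ × E) (hp : ∀ k, (p (k + 1)).1 = φ (p k).1 (p k).2)
    (hlim : Tendsto p atTop (𝓝 0)) : ∀ᶠ k in atTop, (p k).1 = 0 := by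
  have h1 : Tendsto (fun k => (p k).1) atTop (𝓝 0) := hlim.fst_nhds
  have h2 : Tendsto (fun k => (p k).2) atTop (𝓝 0) := hlim.snd_nhds
  have hA : ∀ᶠ k in atTop, |(p k).1| ≤ δ₁ := by
    have := (Metric.tendsto_nhds.1 h1) δ₁ hδ₁
    refine this.mono fun k hk => ?_
    rw [Real.dist_0_eq_abs] at hk
    exact hk.le
  have hB : ∀ᶠ k in atTop, ‖(p k).2‖ ≤ δ₁ := by
    have := (Metric.tendsto_nhds.1 h2) δ₁ hδ₁
    refine this.mono fun k hk => ?_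
    rw [dist_zero_right] at hk
    exact hk.le
  obtain ⟨K, hK⟩ := Filter.eventually_atTop.1 (hA.and hB)
  -- monotonicity of `|g|` along the orbit after time `K`
  have mono : ∀ k, K ≤ k → ∀ m, |(p k).1| ≤ |(p (k + m)).1| := by
    intro k hk m
    induction m with
    | zero => simp
    | succ m ih =>
      have hkm : K ≤ k + m := hk.trans (Nat.le_add_right k m)
      obtain ⟨hg, hy⟩ := hK (k + m) hkm
      have hstep := abs_le_abs_map H hC hδ₁δ h4 hg hy
      rw [← hp (k + m)] at hstep
      rw [← add_assoc]
      exact ih.trans hstep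
  refine Filter.eventually_atTop.2 ⟨K, fun k hk => ?_⟩
  by_contra hne
  have hpos : 0 < |(p k).1| := abs_pos.2 hne
  have hC' : ∀ᶠ j in atTop, |(p j).1| < |(p k).1| := by
    have := (Metric.tendsto_nhds.1 h1) _ hpos
    refine this.mono fun j hj => ?_
    rwa [Real.dist_0_eq_abs] at hj
  obtain ⟨J, hJ⟩ := Filter.eventually_atTop.1 hC'
  have hlt := hJ (k + J) (Nat.le_add_left J k)
  have hle := mono k hk J
  exact absurd hlt (not_lt.2 hle)

/-- **Fibre invariance of the box**: with the fibre bound `‖Ψ g y‖ ≤ θ' ‖y‖ + C g²` on `|g|, ‖y‖ ≤ δ` and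
`θ' δ₁ + C δ₁² ≤ δ₁`, an orbit whose couplings stay in `[-δ₁, δ₁]` up to time `k` and whose fibre starts in
`B̄_{δ₁}` has its fibre in `B̄_{δ₁}` at time `k`. [folklore] -/
theorem norm_snd_le_of_forall_abs_le
    (HΨ : ∀ g : ℝ, ∀ y : E, |g| ≤ δ → ‖y‖ ≤ δ → ‖Ψ g y‖ ≤ θ' * ‖y‖ + C * g ^ 2)
    (hC : 0 ≤ C) (hθ' : 0 ≤ θ') (hδ₁δ : δ₁ ≤ δ) (hΨsmall : θ' * δ₁ + C * δ₁ ^ 2 ≤ δ₁)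
    (p : ℕ → ℝ × E) (hp2 : ∀ k, (p (k + 1)).2 = Ψ (p k).1 (p k).2)
    (hy0 : ‖(p 0).2‖ ≤ δ₁) (k : ℕ) (hg : ∀ j < k, |(p j).1| ≤ δ₁) : ‖(p k).2‖ ≤ δ₁ := by
  induction k with
  | zero => exact hy0
  | succ k ih =>
    have ih' := ih fun j hj => hg j (hj.trans (Nat.lt_succ_self k))
    have hgk := hg k (Nat.lt_succ_self k)
    have hstep := HΨ (p k).1 (p k).2 (hgk.trans hδ₁δ) (ih'.trans hδ₁δ)
    have hsq : (p k).1 ^ 2 ≤ δ₁ ^ 2 := by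
      have : (p k).1 ^ 2 = |(p k).1| ^ 2 := (sq_abs _).symm
      rw [this]
      exact pow_le_pow_left₀ (abs_nonneg _) hgk 2
    rw [hp2 k]
    calc ‖Ψ (p k).1 (p k).2‖ ≤ θ' * ‖(p k).2‖ + C * (p k).1 ^ 2 := hstep
      _ ≤ θ' * δ₁ + C * δ₁ ^ 2 := by gcongr
      _ ≤ δ₁ := hΨsmall

/-- **Linear growth of the coupling modulus while the orbit stays in the box**: if all couplings stay in
`[-δ₁, δ₁]` and the fibre starts in `B̄_{δ₁}`, then `|g₀| + k · (b/2)|g₀|³ ≤ |g_k|`. [folklore] -/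
theorem abs_fst_growth
    (H : ∀ g : ℝ, ∀ y : E, |g| ≤ δ → ‖y‖ ≤ δ →
      |φ g y - (g + b * g ^ 3)| ≤ C * (g ^ 4 + |g| ^ 3 * ‖y‖))
    (HΨ : ∀ g : ℝ, ∀ y : E, |g| ≤ δ → ‖y‖ ≤ δ → ‖Ψ g y‖ ≤ θ' * ‖y‖ + C * g ^ 2)
    (hC : 0 ≤ C) (hθ' : 0 ≤ θ') (hδ₁δ : δ₁ ≤ δ) (h4 : 4 * C * δ₁ ≤ b)
    (hΨsmall : θ' * δ₁ + C * δ₁ ^ 2 ≤ δ₁)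
    (p : ℕ → ℝ × E) (hp : ∀ k, (p (k + 1)).1 = φ (p k).1 (p k).2)
    (hp2 : ∀ k, (p (k + 1)).2 = Ψ (p k).1 (p k).2)
    (hy0 : ‖(p 0).2‖ ≤ δ₁) (hg : ∀ j, |(p j).1| ≤ δ₁) (k : ℕ) :
    |(p 0).1| + k * (b / 2 * |(p 0).1| ^ 3) ≤ |(p k).1| := by
  have hb0 : 0 ≤ b := by
    have : 0 ≤ δ₁ := (abs_nonneg _).trans (hg 0)
    nlinarith
  have hc0 : 0 ≤ b / 2 * |(p 0).1| ^ 3 := by positivity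
  induction k with
  | zero => simp
  | succ k ih =>
    have hyk : ‖(p k).2‖ ≤ δ₁ :=
      norm_snd_le_of_forall_abs_le HΨ hC hθ' hδ₁δ hΨsmall p hp2 hy0 k fun j _ => hg j
    have hstep := abs_add_le_abs_map H hC hδ₁δ h4 (hg k) hyk
    rw [← hp k] at hstep
    have hge0 : |(p 0).1| ≤ |(p k).1| := by
      have : (0 : ℝ) ≤ k * (b / 2 * |(p 0).1| ^ 3) := by positivity
      linarith
    have hcube : |(p 0).1| ^ 3 ≤ |(p k).1| ^ 3 := pow_le_pow_left₀ (abs_nonneg _) hge0 3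
    have hcube' : b / 2 * |(p 0).1| ^ 3 ≤ b / 2 * |(p k).1| ^ 3 :=
      mul_le_mul_of_nonneg_left hcube (by positivity)
    push_cast
    linarith

/-- **Escape from the box** ("the free fixed point is a repeller in its only marginal direction"): with `0 < b`,
an orbit whose fibre starts in `B̄_{δ₁}` and whose coupling starts at `g₀ ≠ 0` reaches a coupling of modulus
`> δ₁` (at time `0` if already `|g₀| > δ₁`). [folklore] -/
theorem exists_escape
    (H : ∀ g : ℝ, ∀ y : E, |g| ≤ δ → ‖y‖ ≤ δ →
      |φ g y - (g + b * g ^ 3)| ≤ C * (g ^ 4 + |g| ^ 3 * ‖y‖))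
    (HΨ : ∀ g : ℝ, ∀ y : E, |g| ≤ δ → ‖y‖ ≤ δ → ‖Ψ g y‖ ≤ θ' * ‖y‖ + C * g ^ 2)
    (hb : 0 < b) (hC : 0 ≤ C) (hθ' : 0 ≤ θ') (hδ₁δ : δ₁ ≤ δ) (h4 : 4 * C * δ₁ ≤ b)
    (hΨsmall : θ' * δ₁ + C * δ₁ ^ 2 ≤ δ₁)
    (p : ℕ → ℝ × E) (hp : ∀ k, (p (k + 1)).1 = φ (p k).1 (p k).2)
    (hp2 : ∀ k, (p (k + 1)).2 = Ψ (p k).1 (p k).2)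
    (hy0 : ‖(p 0).2‖ ≤ δ₁) (hne : (p 0).1 ≠ 0) :
    ∃ k, δ₁ < |(p k).1| := by
  by_contra hcon'
  have hcon : ∀ k, |(p k).1| ≤ δ₁ := fun k => not_lt.1 fun h => hcon' ⟨k, h⟩
  have hpos : 0 < |(p 0).1| := abs_pos.2 hne
  have hc : 0 < b / 2 * |(p 0).1| ^ 3 := by positivity
  obtain ⟨k, hk⟩ := exists_nat_gt (δ₁ / (b / 2 * |(p 0).1| ^ 3))
  have hk' : δ₁ < k * (b / 2 * |(p 0).1| ^ 3) := (div_lt_iff₀ hc).1 hk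
  have hgrowth := abs_fst_growth H HΨ hC hθ' hδ₁δ h4 hΨsmall p hp hp2 hy0 hcon k
  have := hcon k
  linarith

/-- **The local stable set of the free fixed point lies in `{g = 0}`**: an orbit that keeps all its couplings
in `[-δ₁, δ₁]` (fibre started in `B̄_{δ₁}`) started at coupling `0`. [folklore] -/
theorem fst_eq_zero_of_forall_abs_le
    (H : ∀ g : ℝ, ∀ y : E, |g| ≤ δ → ‖y‖ ≤ δ →
      |φ g y - (g + b * g ^ 3)| ≤ C * (g ^ 4 + |g| ^ 3 * ‖y‖))
    (HΨ : ∀ g : ℝ, ∀ y : E, |g| ≤ δ → ‖y‖ ≤ δ → ‖Ψ g y‖ ≤ θ' * ‖y‖ + C * g ^ 2)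
    (hb : 0 < b) (hC : 0 ≤ C) (hθ' : 0 ≤ θ') (hδ₁δ : δ₁ ≤ δ) (h4 : 4 * C * δ₁ ≤ b)
    (hΨsmall : θ' * δ₁ + C * δ₁ ^ 2 ≤ δ₁)
    (p : ℕ → ℝ × E) (hp : ∀ k, (p (k + 1)).1 = φ (p k).1 (p k).2)
    (hp2 : ∀ k, (p (k + 1)).2 = Ψ (p k).1 (p k).2)
    (hy0 : ‖(p 0).2‖ ≤ δ₁) (hg : ∀ k, |(p k).1| ≤ δ₁) : (p 0).1 = 0 := by
  by_contra hne
  obtain ⟨k, hk⟩ := exists_escape H HΨ hb hC hθ' hδ₁δ h4 hΨsmall p hp hp2 hy0 hne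
  exact absurd (hg k) (not_le.2 hk)

/-- **A repeller radius exists** for any constants `0 < δ`, `0 < b`, `0 ≤ C`, `θ' < 1`: some `0 < δ₁ ≤ δ` with
`4 C δ₁ ≤ b` and `θ' δ₁ + C δ₁² ≤ δ₁` (take `δ₁ = min δ (min (b/(4(C+1))) ((1 − θ')/(C+1)))`). [folklore] -/
theorem exists_repellerRadius_of_consts {b C δ θ' : ℝ} (hδ : 0 < δ) (hb : 0 < b) (hC : 0 ≤ C)
    (hθ' : θ' < 1) :
    ∃ δ₁ : ℝ, 0 < δ₁ ∧ δ₁ ≤ δ ∧ 4 * C * δ₁ ≤ b ∧ θ' * δ₁ + C * δ₁ ^ 2 ≤ δ₁ := by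
  have hC1 : 0 < C + 1 := by linarith
  set d := min δ (min (b / (4 * (C + 1))) ((1 - θ') / (C + 1))) with hd
  have hd0 : 0 < d := lt_min hδ (lt_min (by positivity) (div_pos (by linarith) hC1))
  have hdb : d ≤ b / (4 * (C + 1)) := (min_le_right _ _).trans (min_le_left _ _)
  have hdθ : d ≤ (1 - θ') / (C + 1) := (min_le_right _ _).trans (min_le_right _ _)
  refine ⟨d, hd0, min_le_left _ _, ?_, ?_⟩
  · have h1 : 4 * (C + 1) * d ≤ b := by
      calc 4 * (C + 1) * d ≤ 4 * (C + 1) * (b / (4 * (C + 1))) :=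
            mul_le_mul_of_nonneg_left hdb (by positivity)
        _ = b := by field_simp
    nlinarith
  · have h1 : (C + 1) * d ≤ 1 - θ' := by
      calc (C + 1) * d ≤ (C + 1) * ((1 - θ') / (C + 1)) := mul_le_mul_of_nonneg_left hdθ hC1.le
        _ = 1 - θ' := by field_simp
    have h2 : θ' + C * d ≤ 1 := by nlinarith
    calc θ' * d + C * d ^ 2 = (θ' + C * d) * d := by ring
      _ ≤ 1 * d := mul_le_mul_of_nonneg_right h2 hd0.le
      _ = d := one_mul d

/-- **A repeller radius with `b δ₁² ≤ 1`** (additionally shrink below `1/(b+1)`, using `b ≤ (b+1)²`): the extra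
smallness makes the inverse-square recursion `1/g_{k+1}² ≤ 1/g_k² − b/2` available. [folklore] -/
theorem exists_repellerRadius_of_consts' {b C δ θ' : ℝ} (hδ : 0 < δ) (hb : 0 < b) (hC : 0 ≤ C)
    (hθ' : θ' < 1) :
    ∃ δ₁ : ℝ, 0 < δ₁ ∧ δ₁ ≤ δ ∧ 4 * C * δ₁ ≤ b ∧ θ' * δ₁ + C * δ₁ ^ 2 ≤ δ₁ ∧ b * δ₁ ^ 2 ≤ 1 := by
  obtain ⟨δ₁, hδ₁, hδ₁δ, h4, hΨ⟩ := exists_repellerRadius_of_consts hδ hb hC hθ'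
  set d := min δ₁ (1 / (b + 1)) with hd
  have hd0 : 0 < d := lt_min hδ₁ (by positivity)
  have hdδ₁ : d ≤ δ₁ := min_le_left _ _
  have hdb : d ≤ 1 / (b + 1) := min_le_right _ _
  refine ⟨d, hd0, hdδ₁.trans hδ₁δ, ?_, ?_, ?_⟩
  · calc 4 * C * d ≤ 4 * C * δ₁ := by gcongr
      _ ≤ b := h4
  · have h1 : θ' + C * δ₁ ≤ 1 := by
      have e : θ' * δ₁ + C * δ₁ ^ 2 = (θ' + C * δ₁) * δ₁ := by ring
      rw [e] at hΨ
      by_contra hlt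
      push Not at hlt
      have : δ₁ < (θ' + C * δ₁) * δ₁ := by nlinarith
      linarith
    have h2 : θ' + C * d ≤ 1 := by nlinarith
    calc θ' * d + C * d ^ 2 = (θ' + C * d) * d := by ring
      _ ≤ 1 * d := mul_le_mul_of_nonneg_right h2 hd0.le
      _ = d := one_mul d
  · have hd1 : d * (b + 1) ≤ 1 := by
      rw [← le_div_iff₀ (by positivity : (0 : ℝ) < b + 1)]
      exact hdb
    have hsq : (d * (b + 1)) ^ 2 ≤ 1 := pow_le_one₀ (by positivity) hd1
    calc b * d ^ 2 ≤ (b + 1) ^ 2 * d ^ 2 := mul_le_mul_of_nonneg_right (by nlinarith) (sq_nonneg d)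
      _ = (d * (b + 1)) ^ 2 := by ring
      _ ≤ 1 := hsq

end Abstract

end Summit.QuantumFields.YangMills.Theorems.RepellerLemma
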